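import Summits.Ventures.HSemireg.WedgeHankelClassSpaceIrreducible
import Summits.Ventures.HSemireg.WedgeHankelSiegelClassesStable

/-!
# Venture HSemireg — OVER A FINITE FIELD WITH FEWER THAN `n` ELEMENTS TH-7's CLASS SPACE OF DEGREE `n` IS REDUCIBLE UNDER THE SUBSTITUTIONS, WHATEVER THE BINOMIAL
# COEFFICIENTS: the `|K| + 1` RATIONAL POINT CLASSES `w_n(c^•)` (`c ∈ K`) and `E_n` span a proper non-zero subspace stable under every `SbC g`
# (e.g. `K = 𝔽₂`, `n = 3`: every `C(3,j)` is odd, yet the class space is reducible — the element of order `> n` in the companion criterion cannot be dropped)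

HONEST FRAMING. Part of the Lean index of the computation cell `pub-hsemireg` (seat p10 gen 21, Sunday typer «UNIFORM-IN-n»).
Finite-dimensional EXTERIOR ALGEBRA + linear algebra ONLY: no variety, no cohomology theory, no sheaf, no Ext group, no semiregularity map;
nothing here says that HC / HC_CM / HC_AV holds; no Literature fact is declared or used.  Custodian versions as in `WedgeHankelSiegelIdeal` (1/3) and `WedgeHankelFrameChange`;
the dictionary (the pure class `w_n(c^•)` = the `n`-th power of the linear form of the point `c ∈ P¹(K)`, `E_n` = the point at `∞`; the rational points of the Veronese
curve span a `GL₂(K)`-submodule, proper when `|P¹(K)| < n + 1`) is QUOTED, never asserted.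

WHAT IS IN THE TREE.  I4 (`WedgeHankelSubstitutionEigen`): `Sb_w_pure_of_ne` (the pure class of the node `c` goes to `(α+cγ)^n` times the pure class of its Möbius image
`(β+cδ)/(α+cγ)`), `Sb_w_pure_of_eq` (`α + cγ = 0`: to `(β+cδ)^n • E_n`); J8 `Sb_w_spike_top` (`Sb g E_n = w_n(γ^{n−j}δ^j)`); J9 (`WedgeHankelClassSpaceIrreducible`):
irreducible under shear + swap when `n! ≠ 0`; the companion leaf `WedgeHankelClassSpaceIrreducibleCharP` (this seat): irreducible iff all `C(n,j)` are units, PROVIDED `K` has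
an element with `n + 1` distinct powers.  THIS FILE (namespace `Summit.Ventures.HSemireg.Wedge.HankelFrameChange` continued; imports J9, J8) shows that proviso is needed:
* §277 THE RATIONAL POINT CLASSES: `pointClassFamily` is NOT a definition — the family `Option K → spikeSpan n`, `none ↦ E_n`, `some c ↦ w_n(c^•)`, is written inline;
  `w_frame_pow_eq_smul_pure` (`w_n(γ^{n−j}δ^j) = γ^n • w_n((δ/γ)^•)` for `γ ≠ 0`), `w_frame_pow_eq_smul_point` (`γ = 0`: `= δ^n • E_n`), **`SbC_pure_mem_span_points`** and
  **`SbC_point_mem_span_points`** (every substitution maps each rational point class into the span of the rational point classes), hence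
  **`SbC_mem_span_points`** (the span is stable under every `SbC g`), `span_points_ne_bot`, **`finrank_span_points_le`** (`≤ |K| + 1`), `span_points_ne_top` (`|K| < n`).
* §278 **`exists_stable_ne_bot_ne_top_of_card_lt`: `K` finite with `|K| < n` ⇒ th-7's class space of degree `n` has a proper non-zero subspace stable under ALL substitutions**
  (reducible, regardless of the `C(n,j)`), and `not_forall_stable_eq_top_of_card_lt`; `not_injective_pow_of_card_le` (no `t ∈ K` has `n + 1` distinct powers once `|K| ≤ n`)
  — the hypothesis of the companion criterion fails exactly there.
NOT typed here: `|K| = n` and `n + 1` (the rational point classes then span the whole class space: Vandermonde); the structure of the span as a permutation-type module;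
anything Ext-side.  No definitions; new names only.
-/

open Module

namespace Summit.Ventures.HSemireg.Wedge.HankelFrameChange

open Summit.Ventures.HSemireg.Wedge Summit.Ventures.HSemireg.Wedge.Kunneth Summit.Ventures.HSemireg.Wedge.Hankel
  Summit.Ventures.HSemireg.Wedge.BasisFree Summit.Ventures.HSemireg.Wedge.HankelSiegel Summit.Ventures.HSemireg.Wedge.HankelSiegelIdeal
  Summit.Ventures.HSemireg.Wedge.KunnethKernel Summit.Ventures.HSemireg.Wedge.HankelRankOne Summit.Ventures.HSemireg.Wedge.KernelDuality

variable (K : Type*) [Field K] {n : ℕ}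

/-! ## §277. The span of the rational point classes is stable under every substitution -/

/-- `w_n(γ^{n−j}δ^j) = γ^n • w_n((δ/γ)^•)` for `γ ≠ 0` (the image of `E_n` is a multiple of the pure class of the node `δ/γ`). -/
theorem w_frame_pow_eq_smul_pure {γ : K} (hγ : γ ≠ 0) (δ : K) : w K n n (fun j => γ ^ (n - j) * δ ^ j) = γ ^ n • w K n n (fun j => (δ / γ) ^ j) := by
  rw [← w_smul]
  refine w_eq_of_agree K n fun j hj => ?_
  rw [div_pow, mul_div_assoc', eq_div_iff (pow_ne_zero _ hγ), mul_assoc, mul_comm (δ ^ j), ← mul_assoc, ← pow_add, Nat.sub_add_cancel hj]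

/-- `γ = 0`: `w_n(0^{n−j}δ^j) = δ^n • E_n`. -/
theorem w_frame_pow_eq_smul_point (δ : K) : w K n n (fun j => (0 : K) ^ (n - j) * δ ^ j) = δ ^ n • w K n n (fun j => if j = n then (1 : K) else 0) := by
  rw [← w_smul]
  refine w_eq_of_agree K n fun j hj => ?_
  by_cases h : j = n
  · rw [h, if_pos rfl, Nat.sub_self, pow_zero, one_mul, mul_one]
  · rw [if_neg h, zero_pow (by omega), zero_mul, mul_zero]

/-- **every substitution maps a rational pure class `w_n(c^•)` into the span of the rational point classes** (`Option K`-indexed: `none ↦ E_n`, `some c ↦ w_n(c^•)`):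
to `(α+cγ)^n •` the pure class of the Möbius image, or to `(β+cδ)^n • E_n` when `α + cγ = 0` (I4). -/
theorem SbC_pure_mem_span_points (α β γ δ c : K) :
    SbC K α β γ δ (⟨w K n n (fun j => c ^ j), w_mem_spikeSpan K _⟩ : spikeSpan K n) ∈
      Submodule.span K (Set.range fun o : Option K => (o.elim ⟨w K n n (fun j => if j = n then (1 : K) else 0), w_mem_spikeSpan K _⟩
        (fun c' => ⟨w K n n (fun j => c' ^ j), w_mem_spikeSpan K _⟩) : spikeSpan K n)) := by
  by_cases ha : α + c * γ = 0
  · have e : SbC K α β γ δ (⟨w K n n (fun j => c ^ j), w_mem_spikeSpan K _⟩ : spikeSpan K n) =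
        (β + c * δ) ^ n • (⟨w K n n (fun j => if j = n then (1 : K) else 0), w_mem_spikeSpan K _⟩ : spikeSpan K n) :=
      Subtype.ext (by rw [SbC_apply_coe, Submodule.coe_smul]; exact Sb_w_pure_of_eq K ha β δ le_rfl)
    rw [e]
    exact Submodule.smul_mem _ _ (Submodule.subset_span ⟨none, rfl⟩)
  · have e : SbC K α β γ δ (⟨w K n n (fun j => c ^ j), w_mem_spikeSpan K _⟩ : spikeSpan K n) =
        (α + c * γ) ^ n • (⟨w K n n (fun j => ((β + c * δ) / (α + c * γ)) ^ j), w_mem_spikeSpan K _⟩ : spikeSpan K n) :=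
      Subtype.ext (by rw [SbC_apply_coe, Submodule.coe_smul]; exact Sb_w_pure_of_ne K ha β δ le_rfl)
    rw [e]
    exact Submodule.smul_mem _ _ (Submodule.subset_span ⟨some ((β + c * δ) / (α + c * γ)), rfl⟩)

/-- **every substitution maps the point class `E_n` into the span of the rational point classes**: to `γ^n •` the pure class of `δ/γ`, or to `δ^n • E_n` when `γ = 0` (J8
`Sb_w_spike_top`). -/
theorem SbC_point_mem_span_points (α β γ δ : K) :
    SbC K α β γ δ (⟨w K n n (fun j => if j = n then (1 : K) else 0), w_mem_spikeSpan K _⟩ : spikeSpan K n) ∈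
      Submodule.span K (Set.range fun o : Option K => (o.elim ⟨w K n n (fun j => if j = n then (1 : K) else 0), w_mem_spikeSpan K _⟩
        (fun c' => ⟨w K n n (fun j => c' ^ j), w_mem_spikeSpan K _⟩) : spikeSpan K n)) := by
  by_cases hγ : γ = 0
  · have e : SbC K α β γ δ (⟨w K n n (fun j => if j = n then (1 : K) else 0), w_mem_spikeSpan K _⟩ : spikeSpan K n) =
        δ ^ n • (⟨w K n n (fun j => if j = n then (1 : K) else 0), w_mem_spikeSpan K _⟩ : spikeSpan K n) :=
      Subtype.ext (by rw [SbC_apply_coe, Submodule.coe_smul, Sb_w_spike_top, hγ]; exact w_frame_pow_eq_smul_point K δ)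
    rw [e]
    exact Submodule.smul_mem _ _ (Submodule.subset_span ⟨none, rfl⟩)
  · have e : SbC K α β γ δ (⟨w K n n (fun j => if j = n then (1 : K) else 0), w_mem_spikeSpan K _⟩ : spikeSpan K n) =
        γ ^ n • (⟨w K n n (fun j => (δ / γ) ^ j), w_mem_spikeSpan K _⟩ : spikeSpan K n) :=
      Subtype.ext (by rw [SbC_apply_coe, Submodule.coe_smul, Sb_w_spike_top]; exact w_frame_pow_eq_smul_pure K hγ δ)
    rw [e]
    exact Submodule.smul_mem _ _ (Submodule.subset_span ⟨some (δ / γ), rfl⟩)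

/-- **THE SPAN OF THE RATIONAL POINT CLASSES IS STABLE UNDER EVERY SUBSTITUTION.** -/
theorem SbC_mem_span_points (α β γ δ : K) {f : spikeSpan K n}
    (hf : f ∈ Submodule.span K (Set.range fun o : Option K => (o.elim ⟨w K n n (fun j => if j = n then (1 : K) else 0), w_mem_spikeSpan K _⟩
        (fun c' => ⟨w K n n (fun j => c' ^ j), w_mem_spikeSpan K _⟩) : spikeSpan K n))) :
    SbC K α β γ δ f ∈ Submodule.span K (Set.range fun o : Option K => (o.elim ⟨w K n n (fun j => if j = n then (1 : K) else 0), w_mem_spikeSpan K _⟩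
        (fun c' => ⟨w K n n (fun j => c' ^ j), w_mem_spikeSpan K _⟩) : spikeSpan K n)) := by
  induction hf using Submodule.span_induction with
  | mem x hx =>
    obtain ⟨o, rfl⟩ := hx
    cases o with
    | none => exact SbC_point_mem_span_points K α β γ δ
    | some c => exact SbC_pure_mem_span_points K α β γ δ c
  | zero => rw [map_zero]; exact Submodule.zero_mem _
  | add x y _ _ hx hy => rw [map_add]; exact Submodule.add_mem _ hx hy
  | smul c x _ hx => rw [map_smul]; exact Submodule.smul_mem _ _ hx

/-- the span is non-zero (it contains `E_n ≠ 0`). -/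
theorem span_points_ne_bot :
    Submodule.span K (Set.range fun o : Option K => (o.elim ⟨w K n n (fun j => if j = n then (1 : K) else 0), w_mem_spikeSpan K _⟩
        (fun c' => ⟨w K n n (fun j => c' ^ j), w_mem_spikeSpan K _⟩) : spikeSpan K n)) ≠ ⊥ := by
  rw [Submodule.ne_bot_iff]
  refine ⟨_, Submodule.subset_span ⟨none, rfl⟩, fun h => w_spike_ne_zero K le_rfl (congrArg Subtype.val h)⟩

/-- **over a finite field its dimension is at most `|K| + 1`** (it is spanned by `|K| + 1` vectors). -/
theorem finrank_span_points_le [Fintype K] :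
    finrank K ↥(Submodule.span K (Set.range fun o : Option K => (o.elim ⟨w K n n (fun j => if j = n then (1 : K) else 0), w_mem_spikeSpan K _⟩
        (fun c' => ⟨w K n n (fun j => c' ^ j), w_mem_spikeSpan K _⟩) : spikeSpan K n))) ≤ Fintype.card K + 1 := by
  classical
  exact (finrank_range_le_card _).trans (by rw [Fintype.card_option])

/-- **… so it is a PROPER subspace once `|K| < n`** (`dim spikeSpan n = n + 1`). -/
theorem span_points_ne_top [Fintype K] (h : Fintype.card K < n) :
    Submodule.span K (Set.range fun o : Option K => (o.elim ⟨w K n n (fun j => if j = n then (1 : K) else 0), w_mem_spikeSpan K _⟩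
        (fun c' => ⟨w K n n (fun j => c' ^ j), w_mem_spikeSpan K _⟩) : spikeSpan K n)) ≠ ⊤ := by
  intro ht
  have h1 := finrank_span_points_le K (n := n)
  rw [ht, finrank_top, finrank_eq_card_basis (spikeBasis K n), Fintype.card_fin] at h1
  omega

/-! ## §278. Reducibility over small finite fields -/

/-- **OVER A FINITE FIELD WITH `|K| < n`, TH-7's CLASS SPACE OF DEGREE `n` HAS A PROPER NON-ZERO SUBSPACE STABLE UNDER ALL SUBSTITUTIONS** (the span of the rational point
classes) — reducible WHATEVER the binomial coefficients `C(n,j)` (e.g. `K = 𝔽₂`, `n = 3`: all `C(3,j)` odd). -/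
theorem exists_stable_ne_bot_ne_top_of_card_lt [Fintype K] (h : Fintype.card K < n) :
    ∃ W : Submodule K (spikeSpan K n), (∀ α β γ δ : K, ∀ f ∈ W, SbC K α β γ δ f ∈ W) ∧ W ≠ ⊥ ∧ W ≠ ⊤ :=
  ⟨_, fun α β γ δ _ hf => SbC_mem_span_points K α β γ δ hf, span_points_ne_bot K, span_points_ne_top K h⟩

/-- hence **irreducibility under all substitutions FAILS over a finite field with `|K| < n`.** -/
theorem not_forall_stable_eq_top_of_card_lt [Fintype K] (h : Fintype.card K < n) :
    ¬ ∀ W : Submodule K (spikeSpan K n), (∀ α β γ δ : K, ∀ f ∈ W, SbC K α β γ δ f ∈ W) → W ≠ ⊥ → W = ⊤ := by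
  obtain ⟨W, hW, hb, ht⟩ := exists_stable_ne_bot_ne_top_of_card_lt K h
  exact fun hall => ht (hall W hW hb)

omit [Field K] in
/-- consistency with the companion criterion: **once `|K| ≤ n`, no `t ∈ K` has `n + 1` pairwise distinct powers `t^0, …, t^n`** (pigeonhole). -/
theorem not_injective_pow_of_card_le (K : Type*) [Monoid K] [Fintype K] (h : Fintype.card K ≤ n) (t : K) :
    ¬ Function.Injective fun q : Fin (n + 1) => t ^ (q : ℕ) := by
  intro hinj
  have := Fintype.card_le_of_injective _ hinj
  rw [Fintype.card_fin] at this
  omega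

end Summit.Ventures.HSemireg.Wedge.HankelFrameChange
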